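import Mathlib
import Summits.ResolutionOfSingularities.ResolutionOfSingularities.Theorems.WildQuotientsWildQuotientResolutionPthConeFanChartMid
import Summits.ResolutionOfSingularities.ResolutionOfSingularities.Theorems.WildQuotientsWildQuotientResolutionPthConeFanIneq

/-!
# The three vertex charts of `Bl_𝔞 (1/p)(1 on A, −1 off A)` are affine spaces
(crux stmt-ResolutionOfSingularities-15640 `WildQuotients.WildQuotientResolution`, line `Sketch`;
chain w45c POST-V5 S2 brick F6 `…ConductorOneToricFan` = toric brick `T(a,b)` of res-L1-w45c-lead-1's
`S2-DESIGN.md` §3 / §7 (7.6). [OURS · L1 W4.5c] — NOT a statement of any manuscript; replaces the role of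
no printed item. Owner res-L1-w45c-stub-4 (gen 5).)

The generic chart lemmas `PthCone.isRegularRing_chartRing_endVertex` (…ChartEnd) and
`PthCone.isRegularRing_chartRing_midVertex` (…ChartMid) instantiated at the fan family
`PthCone.fanFamily n p A k` (…FanDefs), with the facet inequalities `PthCone.pairing_fanExp_ge` (…FanIneq):
* `PthCone.isRegularRing_chartRing_v0` — the `A`-end vertex `x_ρ^{p(p−1)}` (`(S,T) = (A, Aᶜ)`);
* `PthCone.isRegularRing_chartRing_vp` — the `Aᶜ`-end vertex `x_{ρ'}^{p(p−1)}` (`(S,T) = (Aᶜ, A)`);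
* `PthCone.isRegularRing_chartRing_vm` — the middle vertices `x_ρ^{(p−j)(p−j−1)}x_{ρ'}^{j(j+1)}`,
  `1 ≤ j ≤ p−2` (`a = p−j`, `b = j`).
No notation.
-/

set_option linter.dupNamespace false

noncomputable section

open MvPolynomial
open Literature.AlgebraicGeometry.Resolution

namespace Summit.ResolutionOfSingularities.ResolutionOfSingularities.Theorems.WildQuotientResolution.PthCone

open ConductorOne

variable (k : Type) [Field k] (n p : ℕ) (A : Finset (Fin n)) [hp : Fact p.Prime]

/-- Every variable is in `A` or in `Aᶜ`. [folklore] -/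
theorem mem_or_mem_compl (l : Fin n) : l ∈ A ∨ l ∈ Aᶜ := by
  by_cases h : l ∈ A
  · exact Or.inl h
  · exact Or.inr (Finset.mem_compl.mpr h)

/-- No variable is in both `A` and `Aᶜ`. [folklore] -/
theorem not_mem_and_mem_compl (l : Fin n) : ¬(l ∈ A ∧ l ∈ Aᶜ) := fun h => Finset.mem_compl.mp h.2 h.1

/-- Weight `0` for `chartWeight p n A` means `p ∣ Σ_A d − Σ_{Aᶜ} d`. [OURS · L1 W4.5c] -/
theorem dvd_sub_of_weight_eq_zero (d : Fin n →₀ ℕ) (hd : Finsupp.weight (chartWeight p n A) d = 0) :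
    (p : ℤ) ∣ (∑ l ∈ A, (d l : ℤ)) - ∑ l ∈ Aᶜ, (d l : ℤ) := by
  rw [weight_chartWeight] at hd
  refine (ZMod.intCast_zmod_eq_zero_iff_dvd _ p).mp ?_
  push_cast at hd ⊢
  exact hd

/-- The same divisibility with the roles of `A` and `Aᶜ` exchanged. [OURS · L1 W4.5c] -/
theorem dvd_sub_of_weight_eq_zero' (d : Fin n →₀ ℕ) (hd : Finsupp.weight (chartWeight p n A) d = 0) :
    (p : ℤ) ∣ (∑ l ∈ Aᶜ, (d l : ℤ)) - ∑ l ∈ A, (d l : ℤ) := by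
  rw [← neg_sub]
  exact dvd_neg.mpr (dvd_sub_of_weight_eq_zero n p A d hd)

/-- The value of the re-indexed fan family at a named index. [OURS · L1 W4.5c] -/
theorem coe_fanFamily_equivFin (κ : FIdx n p A) :
    ((fanFamily n p A k (Fintype.equivFin (FIdx n p A) κ) : cone k n p (chartWeight p n A)) :
      MvPolynomial (Fin n) k) = monomial (fanExp n p A κ) 1 := by
  rw [fanFamily_equivFin, coe_fanGen]

/-- Every member of the fan family is a monomial satisfying the facet inequalities. [OURS · L1 W4.5c] -/
theorem exists_fanExp_of_index (i : Fin (Fintype.card (FIdx n p A))) :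
    ∃ κ : FIdx n p A, ((fanFamily n p A k i : cone k n p (chartWeight p n A)) : MvPolynomial (Fin n) k) =
      monomial (fanExp n p A κ) 1 :=
  ⟨(Fintype.equivFin (FIdx n p A)).symm i, rfl⟩

/-- **The `A`-end vertex chart `D₊(x_ρ^{p(p−1)} t)` of `Bl_𝔞` is regular.** [OURS · L1 W4.5c] -/
theorem isRegularRing_chartRing_v0 (ρ : A) :
    IsRegularRing (chartRing (fanFamily n p A k) (Fintype.equivFin (FIdx n p A) (FIdx.v0 ρ))) := by
  classical
  have hp2 : 2 ≤ p := hp.out.two_le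
  let e := Fintype.equivFin (FIdx n p A)
  refine isRegularRing_chartRing_endVertex k n p (chartWeight p n A) (fanFamily n p A k) (e (FIdx.v0 ρ)) hp2
    A Aᶜ (mem_or_mem_compl n A) (not_mem_and_mem_compl n A) (dvd_sub_of_weight_eq_zero n p A) ρ ρ.2
    (coe_fanFamily_equivFin k n p A _) (e (FIdx.q0 ρ)) (coe_fanFamily_equivFin k n p A _)
    (fun l => if h : l ∈ A then e (FIdx.e0 ρ ⟨l, h⟩) else e (FIdx.v0 ρ)) (fun l hl _ => ?_)
    (fun l => if h : l ∈ Aᶜ then e (FIdx.x0 ρ ⟨l, h⟩) else e (FIdx.v0 ρ)) (fun l hl => ?_) (fun i => ?_)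
  · simp only [dif_pos hl]; exact coe_fanFamily_equivFin k n p A _
  · simp only [dif_pos hl]; exact coe_fanFamily_equivFin k n p A _
  · obtain ⟨κ, hκ⟩ := exists_fanExp_of_index k n p A i
    refine ⟨fanExp n p A κ, hκ, ?_⟩
    have h := pairing_fanExp_ge (A := A) κ 1 (by exact_mod_cast (show 1 ≤ p by omega))
    simpa only [mul_one, one_mul] using h

/-- **The `Aᶜ`-end vertex chart `D₊(x_{ρ'}^{p(p−1)} t)` of `Bl_𝔞` is regular.** [OURS · L1 W4.5c] -/
theorem isRegularRing_chartRing_vp (ρ' : (Aᶜ : Finset (Fin n))) :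
    IsRegularRing (chartRing (fanFamily n p A k) (Fintype.equivFin (FIdx n p A) (FIdx.vp ρ'))) := by
  classical
  have hp2 : 2 ≤ p := hp.out.two_le
  let e := Fintype.equivFin (FIdx n p A)
  refine isRegularRing_chartRing_endVertex k n p (chartWeight p n A) (fanFamily n p A k) (e (FIdx.vp ρ')) hp2
    Aᶜ A (fun l => (mem_or_mem_compl n A l).symm) (fun l h => not_mem_and_mem_compl n A l h.symm)
    (dvd_sub_of_weight_eq_zero' n p A) ρ' ρ'.2
    (coe_fanFamily_equivFin k n p A _) (e (FIdx.qp ρ')) (coe_fanFamily_equivFin k n p A _)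
    (fun l => if h : l ∈ Aᶜ then e (FIdx.ep ρ' ⟨l, h⟩) else e (FIdx.vp ρ')) (fun l hl _ => ?_)
    (fun l => if h : l ∈ A then e (FIdx.xp ρ' ⟨l, h⟩) else e (FIdx.vp ρ')) (fun l hl => ?_) (fun i => ?_)
  · simp only [dif_pos hl]; exact coe_fanFamily_equivFin k n p A _
  · simp only [dif_pos hl]; exact coe_fanFamily_equivFin k n p A _
  · obtain ⟨κ, hκ⟩ := exists_fanExp_of_index k n p A i
    refine ⟨fanExp n p A κ, hκ, ?_⟩
    have h := pairing_fanExp_ge (A := A) κ ((p : ℤ) - 1) (by linarith)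
    have h1 : (p : ℤ) - ((p : ℤ) - 1) = 1 := by ring
    rw [h1, mul_one, one_mul] at h
    linarith

/-- **The middle vertex charts `D₊(x_ρ^{(p−j−1)(p−j−2)} x_{ρ'}^{(j+1)(j+2)} t)` of `Bl_𝔞` are regular**
(`j + 1 ∈ [1, p−2]`). [OURS · L1 W4.5c] -/
theorem isRegularRing_chartRing_vm (j : Fin (p - 2)) (ρ : A) (ρ' : (Aᶜ : Finset (Fin n))) :
    IsRegularRing (chartRing (fanFamily n p A k) (Fintype.equivFin (FIdx n p A) (FIdx.vm j ρ ρ'))) := by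
  classical
  have hj : (j : ℕ) + 3 ≤ p := by have := j.2; omega
  let e := Fintype.equivFin (FIdx n p A)
  let jq : Fin (p - 1) := ⟨j, by omega⟩
  let jq' : Fin (p - 1) := ⟨(j : ℕ) + 1, by omega⟩
  have hρ'A : (ρ' : Fin n) ∉ A := Finset.mem_compl.mp ρ'.2
  -- `a = p − (j+1)`, `b = j + 1`
  have ca : ((p - ((j : ℕ) + 1) : ℕ) : ℤ) = (p : ℤ) - ((j : ℕ) + 1) := by
    rw [Nat.cast_sub (by omega)]; push_cast; ring
  refine isRegularRing_chartRing_midVertex k n p (chartWeight p n A) (fanFamily n p A k) (e (FIdx.vm j ρ ρ'))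
    A Aᶜ (mem_or_mem_compl n A) (not_mem_and_mem_compl n A) (dvd_sub_of_weight_eq_zero n p A)
    (p - ((j : ℕ) + 1)) ((j : ℕ) + 1) (by omega) (by omega) (by omega) ρ ρ.2 ρ' ρ'.2
    (coe_fanFamily_equivFin k n p A _) (e (FIdx.qm jq ρ ρ')) (coe_fanFamily_equivFin k n p A _)
    (e (FIdx.qm jq' ρ ρ')) ?_
    (fun l => if h : l ∈ A then e (FIdx.ea j ρ ρ' ⟨l, h⟩) else e (FIdx.vm j ρ ρ')) (fun l hl _ => ?_)
    (fun l => if h : l ∈ Aᶜ then e (FIdx.eb j ρ ρ' ⟨l, h⟩) else e (FIdx.vm j ρ ρ')) (fun l hl _ => ?_)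
    (fun i => ?_)
  · rw [coe_fanFamily_equivFin, fanExp_qm, qExp, Nat.sub_sub]
  · simp only [dif_pos hl]
    rw [coe_fanFamily_equivFin, fanExp_ea]
  · simp only [dif_pos hl]
    rw [coe_fanFamily_equivFin, fanExp_eb]
  · obtain ⟨κ, hκ⟩ := exists_fanExp_of_index k n p A i
    refine ⟨fanExp n p A κ, hκ, ?_, ?_⟩
    · have h := pairing_fanExp_ge (A := A) κ ((j : ℕ) + 1) (by linarith)
      rw [ca]
      push_cast at h ⊢
      linear_combination h
    · have h := pairing_fanExp_ge (A := A) κ ((j : ℕ) + 2) (by linarith)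
      rw [ca]
      push_cast at h ⊢
      linear_combination h

end Summit.ResolutionOfSingularities.ResolutionOfSingularities.Theorems.WildQuotientResolution.PthCone

end
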